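import Summits.QuantumFields.BalabanUV.Beta.D1BFx.TorusGhostLegs
import Summits.QuantumFields.BalabanUV.Beta.D1BFx.SortedEmbedding

/-!
# `BalabanUV.Beta.D1BFx.TorusGhostLegsSorted` — road «BF-x» for binder row D1, slot (K), X₃(ii) ROUTE T, brick **K-TB3c PART 1, FILE 3** (addendum):
# «THE TOWER LEG IN THE SORTED CURRENCY»: the scalar ghost leg `Ggh n a` re-blocked over the COARSE lattice (owner's DECISION 1: fine scalar sites
# `= Site 4 p × ((ℤ∕n)⁴ × Unit)`, `SortedReblocking.reblock`) — its torus letter `(reblock AXgh)^·(reblock Ggh)^ = 1 = (reblock Ggh)^·(reblock AXgh)^`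
# on every coarse torus `Site 4 p`, and the ghost `hessT` against re-blocked arrays EQUALS the fine-torus one (FILE 1's currency), so FILE 1's socket
# `tendsto_hessT_Ggh` IS the `p → ∞` limit of the sorted ghost term (`tendsto_hessT_Ggh_sorted`).

HONEST DEPENDENCY (cell records, verbatim): «continuum YM on T⁴ ⇐ BetaPertH ∧ nine spine estimates (0/9 proved); BetaPertH ⇐ (D1) ∧ (D4) ∧
CAP+tail; G-an2-4 gates asym, D1 and NE2/3/4.»  HONEST FRAMING (cell contract, verbatim): «discharging `BetaPertH` makes Bałaban's UV stability
UNCONDITIONAL — a real constructive-QFT result; it is NOT the continuum limit and NOT the Clay problem.»  THIS MODULE DISCHARGES NOTHING of (K),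
of D1 or of the wall: [folklore] re-indexing bookkeeping over leaf-03-g8's `SortedEmbedding` (`e₁`, `periodiseF_reblock_eq_submatrix`,
`reblock_hat_mul_eq_one`, `hessT_submatrix_equiv`) and `SortedReblocking` (`reblock`), the owner's `PeriodisedKernels.isPeriodic₂_AX`, TA2
`PeriodicArrays` (`isPeriodic₂_arr`, `summable_abs_row_arr`), the D1 typer's `GhostLeg` (`summable_Ggh_row`) and this seat's FILE 1 `TorusGhostLegs`
(`periodiseF_AXgh_mul_Ggh`, `isPeriodic₂_Ggh`, `summable_abs_row_AXgh`, `tendsto_hessT_Ggh`) — all USED BY NAME.  No definition, no `def … : Prop`,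
nothing cited, 0 sorry.  NOT D1, NOT BetaPertH, NOT continuum, NOT Clay.

ABSOLUTE RULE (cell charter, verbatim): «No internally-minted statement may enter as a cited fact. Every hypothesis is either kernel-proved in this
package or a verbatim quotation of a PUBLISHED theorem with page reference. The manuscript(s) under audit are NOT citable for their own disputed
steps — they are the thing under adjudication; programme-internal (2001/route/tribunal) claims are never citable.»

WHERE THIS SITS (`K-ASSEMBLY-SPEC-v2.md` v2.2 §0 DECISION 1 «sorted currency», §2 row K-TB3c; FILE 1 = `TorusGhostLegs` (fine torus `Site 4 (n·p) × Unit`),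
FILE 2 = `TorusGhostGram` (coarse torus); K-TB3c PART 2 = ne9-leaf-02-g26's `TorusScalarAveraging`∕`TorusScalarCoarseGram` (the `S₀`-letter, owner's
unfibred currency) — NOT touched here).  TB5 assembles the per-torus identity in the SORTED currency; the ghost tower term `hessT(M̂₀⁻¹; M-jets)` there has
the leg `(reblock n (Ggh n a))^`; THIS FILE says (§1) that leg inverts `(reblock n (AXgh n a))^` and (§2) that its `hessT` against re-blocked arrays is
FILE 1's fine-torus `hessT` (an `Equiv`-re-indexing changes no trace), whence (§3) the `p → ∞` limit.  NOT HERE: the M-jets as arrays of the END's ghost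
rows (K-TB3c PART 2b, after TB4-tables); anything of PART 2.
Provenance: NE9 formalisation swarm leaf seat `b2b-balaban-t4-ne9-formalise-leaf-09` gen 38 (journal l.23187), 2026-08-20.
-/

noncomputable section

namespace Summit.QuantumFields.BalabanUV.Beta.D1BFx.TorusGhostLegsSorted

open Filter Topology
open scoped BigOperators
open Literature.Probability.LatticeModels (TorusSite)
open Literature.MathematicalPhysics.QuantumFieldTheory.Balaban1983to89
open Literature.MathematicalPhysics.QuantumFieldTheory.Balaban1983to89.Beta
open ExpKernelCalculus (Site MKer BiLoc hessKer)
open Summit.QuantumFields.BalabanUV.Beta.D1BFx.FibredPeriodisation (periodiseF)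
open Summit.QuantumFields.BalabanUV.Beta.D1BFx.PeriodicArrays (arr toF isPeriodic₂_arr summable_abs_row_arr)
open Summit.QuantumFields.BalabanUV.Beta.D1BFx.SortedReblocking (reblock)
open Summit.QuantumFields.BalabanUV.Beta.D1BFx.SortedEmbedding (e₁ periodiseF_reblock_eq_submatrix reblock_hat_mul_eq_one hessT_submatrix_equiv)
open Summit.QuantumFields.BalabanUV.Beta.D1BFx.MixedVarPackedHess (hessT)
open Summit.QuantumFields.BalabanUV.Beta.D1BFx.GhostLeg (Ggh summable_Ggh_row pred_add_one)
open Summit.QuantumFields.BalabanUV.Beta.D1BFx.TorusGhostLegs (AXgh summable_abs_row_AXgh isPeriodic₂_Ggh periodiseF_AXgh_mul_Ggh tendsto_hessT_Ggh)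

variable (n : ℕ) [NeZero n] (a : ℝ)

/-! ## §1 The tower letter on the coarse base (sorted currency) -/

section Letter

variable {p : ℕ} [NeZero p]

omit [NeZero p] in
/-- [folklore] Every fibre of the tower operator `AXgh n a` is jointly `(n·p)`-periodic (`PeriodisedKernels.isPeriodic₂_AX` at block side `n − 1 + 1 = n`). -/
theorem isPeriodic₂_AXgh (u v : Unit) : IsPeriodic₂ (n * p) (fun x x' => AXgh n a x x' u v) :=
  PeriodisedKernels.isPeriodic₂_AX (m := n - 1) a (s := n * p) (by rw [pred_add_one]; exact Dvd.intro p rfl)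

omit [NeZero p] in
/-- [folklore] Every fibre of the ghost leg is jointly `(n·p)`-periodic (FILE 1's `isPeriodic₂_Ggh` at `s = n·p`). -/
theorem isPeriodic₂_Ggh_mul (ha : 0 < a) (u v : Unit) : IsPeriodic₂ (n * p) (fun x x' => Ggh n a x x' u v) :=
  isPeriodic₂_Ggh n a ha (Dvd.intro p rfl) u v

/-- [folklore] **THE RE-BLOCKED GHOST LEG IS FILE 1's FINE-TORUS LEG RE-INDEXED**: `(reblock n Ggh)^ = ((toF Ggh)^).submatrix e₁ e₁`
(`SortedEmbedding.periodiseF_reblock_eq_submatrix`). -/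
theorem periodiseF_reblock_Ggh (ha : 0 < a) :
    Matrix.of (periodiseF p (reblock n (Ggh n a))) = (Matrix.of (periodiseF (n * p) (toF (Ggh n a)))).submatrix (e₁ n p) (e₁ n p) :=
  periodiseF_reblock_eq_submatrix (K := Ggh n a) (isPeriodic₂_Ggh_mul n a ha) (fun u v x => summable_Ggh_row n a ha x u v)

/-- [folklore] The same for the tower operator: `(reblock n AXgh)^ = ((toF AXgh)^).submatrix e₁ e₁`. -/
theorem periodiseF_reblock_AXgh :
    Matrix.of (periodiseF p (reblock n (AXgh n a))) = (Matrix.of (periodiseF (n * p) (toF (AXgh n a)))).submatrix (e₁ n p) (e₁ n p) :=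
  periodiseF_reblock_eq_submatrix (K := AXgh n a) (isPeriodic₂_AXgh n a) (fun u v x => (summable_abs_row_AXgh n a u v x).of_abs)

/-- [folklore] **THE TOWER LETTER, SORTED**: on every coarse torus `Site 4 p`, `(reblock AXgh)^ · (reblock Ggh)^ = 1` AND `(reblock Ggh)^ · (reblock AXgh)^ = 1`
— FILE 1's `periodiseF_AXgh_mul_Ggh` at `s = n·p` transported along `e₁` (`SortedEmbedding.reblock_hat_mul_eq_one`). -/
theorem reblock_AXgh_mul_Ggh (ha : 0 < a) :
    Matrix.of (periodiseF p (reblock n (AXgh n a))) * Matrix.of (periodiseF p (reblock n (Ggh n a))) = 1 ∧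
      Matrix.of (periodiseF p (reblock n (Ggh n a))) * Matrix.of (periodiseF p (reblock n (AXgh n a))) = 1 := by
  have hArow : ∀ (u v : Unit) (x : Site 4), Summable fun x' => AXgh n a x x' u v := fun u v x => (summable_abs_row_AXgh n a u v x).of_abs
  have hGrow : ∀ (u v : Unit) (x : Site 4), Summable fun x' => Ggh n a x x' u v := fun u v x => summable_Ggh_row n a ha x u v
  have h := periodiseF_AXgh_mul_Ggh n a ha (Dvd.intro p rfl : n ∣ n * p)
  exact ⟨reblock_hat_mul_eq_one (isPeriodic₂_AXgh n a) hArow (isPeriodic₂_Ggh_mul n a ha) hGrow h.1,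
    reblock_hat_mul_eq_one (isPeriodic₂_Ggh_mul n a ha) hGrow (isPeriodic₂_AXgh n a) hArow h.2⟩

/-- [folklore] … hence `(reblock AXgh)^` is invertible on every coarse torus, -/
theorem isUnit_det_reblock_AXgh (ha : 0 < a) : IsUnit (Matrix.of (periodiseF p (reblock n (AXgh n a)))).det :=
  Matrix.isUnit_det_of_right_inverse (reblock_AXgh_mul_Ggh n a ha).1

/-- [folklore] … with inverse `(reblock Ggh)^` — the `M₀⁻¹` of the ghost split in DECISION 1's currency. -/
theorem inv_reblock_AXgh (ha : 0 < a) :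
    (Matrix.of (periodiseF p (reblock n (AXgh n a))))⁻¹ = Matrix.of (periodiseF p (reblock n (Ggh n a))) :=
  Matrix.inv_eq_right_inv (reblock_AXgh_mul_Ggh n a ha).1

end Letter

/-! ## §2 The ghost `hessT` is currency-free -/

section HessT

variable {p : ℕ} [NeZero p] {V V' W : MKer 4 Unit} {P Q P' Q' R R' : Site 4} {Cv Cv' Cw δ : ℝ}

/-- [folklore] A re-blocked ARRAY is the fine-torus array re-indexed: `(reblock n (arr (n·p) K))^ = ((toF (arr (n·p) K))^).submatrix e₁ e₁` for a bi-localised `K`. -/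
theorem periodiseF_reblock_arr (hK : BiLoc W R R' Cw δ) (hδ : 0 < δ) :
    Matrix.of (periodiseF p (reblock n (arr (n * p) W))) = (Matrix.of (periodiseF (n * p) (toF (arr (n * p) W)))).submatrix (e₁ n p) (e₁ n p) :=
  periodiseF_reblock_eq_submatrix (K := arr (n * p) W) (fun u v => isPeriodic₂_arr (n * p) W u v)
    (fun u v x => (summable_abs_row_arr hK hδ (n * p) u v x).of_abs)

/-- [folklore] **THE SORTED GHOST `hessT` EQUALS THE FINE-TORUS GHOST `hessT`**: for the tower leg and ANY three bi-localised scalar vertices,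
`hessT (reblock Ggh)^ (reblock (arr V))^ (reblock (arr V′))^ (reblock (arr W))^ = hessT (Ggh)^ (arr V)^ (arr V′)^ (arr W)^` (all four matrices are the
fine-torus ones re-indexed along the `Equiv` `e₁`; `SortedEmbedding.hessT_submatrix_equiv`). -/
theorem hessT_reblock_Ggh_eq (ha : 0 < a) (hV : BiLoc V P P' Cv δ) (hV' : BiLoc V' Q' Q Cv' δ) (hW : BiLoc W R R' Cw δ) (hδ : 0 < δ) :
    hessT (Matrix.of (periodiseF p (reblock n (Ggh n a)))) (Matrix.of (periodiseF p (reblock n (arr (n * p) V))))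
        (Matrix.of (periodiseF p (reblock n (arr (n * p) V')))) (Matrix.of (periodiseF p (reblock n (arr (n * p) W)))) =
      hessT (Matrix.of (periodiseF (n * p) (toF (Ggh n a)))) (Matrix.of (periodiseF (n * p) (toF (arr (n * p) V))))
        (Matrix.of (periodiseF (n * p) (toF (arr (n * p) V')))) (Matrix.of (periodiseF (n * p) (toF (arr (n * p) W)))) := by
  rw [periodiseF_reblock_Ggh n a ha, periodiseF_reblock_arr n hV hδ, periodiseF_reblock_arr n hV' hδ, periodiseF_reblock_arr n hW hδ,
    hessT_submatrix_equiv]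

end HessT

/-! ## §3 The sorted ghost socket -/

section Socket

variable {p : ℕ → ℕ} [∀ k, NeZero (p k)] {P Q P' Q' : Site 4} {C Cv Cv' δ : ℝ}

/-- [folklore] **THE GHOST HESS SOCKET IN THE SORTED CURRENCY**: for scalar base-point families `𝒱`, `𝒲` bi-localised at a common rate, along coarse tori
`Site 4 (p k)`, `p k → ∞`, the SORTED one-loop functional of the re-blocked tower leg against the re-blocked arrays converges to the `ℤ⁴` resolvent Hessian
kernel of the ghost leg: `hessT (reblock Ggh)^ (reblock (arr (𝒱 μ 0)))^ (reblock (arr (𝒱 ν z)))^ (reblock (arr (𝒲 μ 0 ν z)))^ → hessKer (Ggh n a) 𝒱 𝒲 μ ν z`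
(§2 + FILE 1's `tendsto_hessT_Ggh`). -/
theorem tendsto_hessT_Ggh_sorted (ha : 0 < a) (𝒱 : Fin 4 → Site 4 → MKer 4 Unit) (𝒲 : Fin 4 → Site 4 → Fin 4 → Site 4 → MKer 4 Unit)
    (μ ν : Fin 4) (z : Site 4) (hV : BiLoc (𝒱 μ 0) P P' Cv δ) (hV' : BiLoc (𝒱 ν z) Q' Q Cv' δ) (hW : BiLoc (𝒲 μ 0 ν z) P Q C δ)
    (hδ : 0 < δ) (hp : Tendsto p atTop atTop) :
    Tendsto (fun k => hessT (Matrix.of (periodiseF (p k) (reblock n (Ggh n a))))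
        (Matrix.of (periodiseF (p k) (reblock n (arr (n * p k) (𝒱 μ 0)))))
        (Matrix.of (periodiseF (p k) (reblock n (arr (n * p k) (𝒱 ν z)))))
        (Matrix.of (periodiseF (p k) (reblock n (arr (n * p k) (𝒲 μ 0 ν z))))))
      atTop (𝓝 (hessKer (Ggh n a) 𝒱 𝒲 μ ν z)) := by
  have h := tendsto_hessT_Ggh n a (p := p) ha 𝒱 𝒲 μ ν z hV hV' hW hδ hp
  refine h.congr fun k => ?_
  exact (hessT_reblock_Ggh_eq n a ha hV hV' hW hδ).symm

end Socket

end Summit.QuantumFields.BalabanUV.Beta.D1BFx.TorusGhostLegsSorted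

end
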